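import Mathlib
import HarnessLib
import Literature.Computability.Complexity.CNF
import Literature.Computability.Complexity.PNPWave0
import Literature.Computability.Complexity.PNPWave0Proofs
import Literature.Computability.Complexity.CookBridges
import Literature.Computability.Complexity.StringEquality
import Summits.PneNP.PneNP.Theorems.OverlapGapAlgebraEvalRelationInP

/-!
# PneNP / OverlapGapAlgebra — `SearchHardWindow` (stmt-PneNP-2460): the solver-test closure

Route `PneNP/OverlapGapAlgebra`, crux stmt-PneNP-2460 (`SearchHardWindow`), line `IdeaSketch_r2_k6`
(lead c4), registered stub `shwW_solverTestClosure` — pure machine plumbing, no mathematics.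

The crux says that random `k`-SAT SEARCH at some density is hard for every polynomial-time word
function `f : {0,1}* → {0,1}*` (input: the `encodingCNF`-code `⌜φ⌝` of a CNF `φ` over `ℕ`; output
word `y = f ⌜φ⌝` read as the table `i ↦ y.getD i false`). Hybrid / decoy arguments use `f` only
through the Boolean TEST "does the table `f ⌜φ⌝` satisfy `φ`?", and need that this test is itself a
polynomial-time PREDICATE of the code (`SolverTestClosure` of
`Cruxes/SearchHardWindow/IdeaSketch_r2_k5.lean`, there on literal arrays; here in the tree's general
CNF vocabulary):

  `∀ f, IsPolyTime f → ∃ T, IsPolyTimePred T ∧ ∀ φ, T ⌜φ⌝ = true ↔ φ.eval (i ↦ (f ⌜φ⌝).getD i false) = true`.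

Proof (composition of polynomial-time machines, Arora–Barak 2009 §1.3 / Thm. 2.8; Sipser 2012,
proof of Thm. 7.31):
1. CNF evaluation is polynomial time as a RELATION: `overlapGap_evalRelationInP` gives
   `R ∈ Classes.P` with `⟨⌜φ⌝, y⟩ ∈ R ↔ φ.eval (i ↦ y.getD i false) = true`
   (`Theorems/OverlapGapAlgebraEvalRelationInP.lean`, route-file-free).
2. `Classes.P = PNPWave0.P Bool` (`p_bool_eq`, `CookBridges.lean`), and a member of Cook's class is
   BY DEFINITION cut out by a polynomial-time Boolean decider `g` (`w ∈ R ↔ g w = true`).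
3. The pairing map `x ↦ ⟨x, f x⟩ = fanoutFn id f` is in `FP` (`fanoutFn_mem_FP`, `fanoutFn_apply`,
   `StringEquality.lean`; `IsPolyTime f ↔ f ∈ FP` is `CookBridges.isPolyTime_iff`).
4. `T := g ∘ fanoutFn id f` is a polynomial-time predicate by `IsPolyTime.comp_isPolyTimePred`
   (`PNPWave0Proofs.lean`), and `T ⌜φ⌝ = g ⟨⌜φ⌝, f ⌜φ⌝⟩`.

This module does NOT import the route file `Summits.PneNP.PneNP.Theses.OverlapGapAlgebra` (nor any
module importing it). No definitions are introduced.

References: S. Arora, B. Barak, *Computational Complexity: A Modern Approach*, CUP 2009, §1.3,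
Thm. 2.8(1) (composition of polynomial-time maps), Def. 1.13 (`P`); M. Sipser, *Introduction to the
Theory of Computation*, 3rd ed., 2012, Thm. 7.31 (proof: "compute `f(w)`, run `M` on `f(w)`").
-/

namespace Summit.PneNP.PneNP.Theorems

set_option linter.dupNamespace false -- `Summit.PneNP.PneNP.…`: summit = sub-problem (D-0017)

open Literature.Computability.Complexity

/-- **Solver-test closure** (stub `shwW_solverTestClosure` of crux stmt-PneNP-2460, line
`IdeaSketch_r2_k6`): for every polynomial-time word function `f` (tree `IsPolyTime`) there is a
polynomial-time Boolean predicate `T` (tree `IsPolyTimePred`) which, on the code `⌜φ⌝` of any CNF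
`φ` over `ℕ`, tests whether the table `i ↦ (f ⌜φ⌝).getD i false` satisfies `φ`. Witness:
`T = g ∘ (x ↦ ⟨x, f x⟩)` with `g` a polynomial-time decider of the evaluation relation
`R ∈ P` of `overlapGap_evalRelationInP` (via `p_bool_eq`), the pairing map being `fanoutFn id f ∈ FP`
and the composite polynomial time by `IsPolyTime.comp_isPolyTimePred`. Off codewords `T` is
unconstrained. [AroraBarakCC2009, §1.3 and Thm. 2.8(1); Sipser2012, Thm. 7.31 (proof)] -/
theorem shwW_solverTestClosure :
    ∀ f : List Bool → List Bool, Literature.Computability.Complexity.IsPolyTime f →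
    ∃ T : List Bool → Bool, Literature.Computability.Complexity.IsPolyTimePred T ∧
    ∀ φ : Literature.Computability.Complexity.CNF ℕ,
    T (Literature.Computability.Complexity.encodingCNF.encode φ) = true ↔
    φ.eval (fun i => (f (Literature.Computability.Complexity.encodingCNF.encode φ)).getD i false) =
    true := by
  intro f hf
  -- (1) CNF evaluation is polynomial time as a relation: `⟨⌜φ⌝, y⟩ ∈ R ↔ φ.eval (y.getD · false)`
  obtain ⟨R, hRP, hR⟩ := overlapGap_evalRelationInP
  -- (2) a polynomial-time Boolean decider `g` of `R` (Cook's `P` over `{0,1}` is `Classes.P`)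
  rw [← p_bool_eq] at hRP
  obtain ⟨g, hg, hgR⟩ := hRP
  -- (3) the pairing map `x ↦ ⟨x, f x⟩` is polynomial time
  have hfFP : f ∈ FP := (CookBridges.isPolyTime_iff f).1 hf
  have hpair : IsPolyTime (fanoutFn (id : List Bool → List Bool) f) :=
    (CookBridges.isPolyTime_iff _).2
      (fanoutFn_mem_FP (PolyTimeComputable.id (id : List Bool → List Bool)) hfFP)
  -- (4) the test `T = g ∘ (x ↦ ⟨x, f x⟩)`
  refine ⟨g ∘ fanoutFn (id : List Bool → List Bool) f, hpair.comp_isPolyTimePred hg, fun φ => ?_⟩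
  rw [Function.comp_apply, fanoutFn_apply, ← hgR (boolPair _ _)]
  exact hR φ (f (encodingCNF.encode φ))

end Summit.PneNP.PneNP.Theorems
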